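import Literature.MathematicalPhysics.QuantumFieldTheory.Balaban1983to89.HiggsCondGauss228

/-!
# `Balaban1983to89.HiggsCondGaussMoments` — T. Bałaban, *(Higgs)₂,₃ quantum fields in a finite volume. I. A lower bound*,
Commun. Math. Phys. **85** (1982) 603–626 [Balaban1982Higgs1] p. 611 (2.32) and *II. An upper bound*, Commun. Math. Phys.
**86** (1982) 555–594 [Balaban1982Higgs2] p. 563 (2.28): the FIRST AND SECOND MOMENTS of the conditional Gaussian measure
`dμ_{C^{(k)}_Λ(Ω,A)}` of the concrete scalar field (`HiggsCondGauss228.condGauss`) — it is Mathlib's centred multivariate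
Gaussian with covariance matrix `A_Λ⁻¹`, its coordinates have mean `0` and covariance `(A_Λ⁻¹)_{bb′} =
(L^kε)^{−d}·(mat C^{(k)}_Λ(Ω,A))_{bb′}` — II p. 563 *"dμ_{A_Λ⁻¹} is a probabilistic Gaussian measure with the covariance A_Λ⁻¹"*
read literally; theorems only

statement-level skeleton of published theorems with citation tags; proofs where landed; nothing here is a claim about the Yang–Mills mass gap

PDFs held: `paper:balaban1982-cmp85-higgs23-i` (journal page = PDF page + 602), p. 611 [PDF 9]; `paper:balaban1982-cmp86-higgs23-ii`
(journal page = PDF page + 554), p. 563 [PDF 9] — read AS IMAGES on the ×2 renders under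
`run/shared/lean/pub/pub-balaban/b2b-balaban-ref1/pages/`.

CITATION HEADER (lean-in-tree rule).  lit-balaban typed skeleton (HOME `run/shared/lean/pub/lit-balaban/`), typer line
(concrete carriers), gen 5; companion of `HiggsCondGauss228` (file 3 of the (2.32) line), following the route of p14's
`B1Eq333GaussianFields` (`gaussProb` ↦ Mathlib's `multivariateGaussian` by p15's
`B2Eq228Conditioning.gaussProb_eq_map_multivariateGaussian`, then `covariance_map` / `covariance_eval_multivariateGaussian`).
SKELETON rows served: **B1.Eq2.30** (member (2.32)), **B2.Eq2.28** (the measure `dμ_{A_Λ⁻¹}` of the model instance); nothing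
of record is restated.  THE SOURCE TEXT, II p. 563, verbatim: *"where dμ_{A_Λ⁻¹} is a probabilistic Gaussian measure with the
covariance A_Λ⁻¹"*; I p. 611: *"C^{(k)}_Λ(Ω, A) = ((aL^{−2}P(A) + Δ^{(k)}(Ω, A))↾_Λ)^{−1}. (2.32)"*.

WHAT THIS FILE PROVES (0 sorry; standard axioms; theorems only), for m² > 0, a > 0, L > 1, k ≤ K, every `A`, `Ω`, `C`, `Λ`:
`condGauss_eq_map_multivariateGaussian` / `map_toLp_condGauss` (`dμ_{C^{(k)}_Λ(Ω,A)}` IS `multivariateGaussian 0 (A_Λ)⁻¹`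
in coordinates), **`integral_apply_condGauss`** (mean zero: `∫ φ′(b) dμ = 0`), **`covariance_apply_condGauss`**
(`cov[φ′(b), φ′(b′); dμ] = (A_Λ⁻¹)_{bb′}`) and **`covariance_apply_condGauss_eq_condCov232`** (`= (L^kε)^{−d}·(mat C^{(k)}_Λ(Ω,A))_{bb′}`,
file 3's `inv_blkIn_formMat`); square integrability `memLp_apply_condGauss` / `integrable_(mul_)apply_condGauss`, second moments
**`integral_mul_apply_condGauss(_eq_condCov232)`** (`∫ φ′(b)φ′(b′) dμ = (A_Λ⁻¹)_{bb′}`), and at FIELD LEVEL for the scalar product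
(1.5): **`integral_siteInner_condGauss`** (`∫⟨f,φ′⟩dμ = 0`) and **`integral_siteInner_mul_siteInner_condGauss`**
(`∫⟨f,φ′⟩⟨g,φ′⟩ dμ_{C^{(k)}_Λ(Ω,A)} = ⟨f, C^{(k)}_Λ(Ω,A)g⟩` — the covariance of `dμ_{C^{(k)}_Λ(Ω,A)}` IS `C^{(k)}_Λ(Ω,A)` of (2.32)),
with the bilinear dictionary `siteInner_condCov232_eq_blkIn₂`.  HONEST SCOPE as in `HiggsCondGauss228`.  Value = kernel certificates for the concrete objects
II (2.45)/(2.46) integrate against; NOT summit progress.  Unit `lit-balaban-typer` gen 5 (literature-prover-lit-balaban-typer-g5-0).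
-/

open scoped BigOperators InnerProductSpace Matrix
open _root_.MeasureTheory _root_.ProbabilityTheory Matrix

namespace Literature.MathematicalPhysics.QuantumFieldTheory.Balaban1983to89.HiggsCondGaussMoments

open HiggsLattice HiggsCovariance B1Eq221Coordinates B1Eq230FluctCov B2Eq255Concrete HiggsCondCov232 HiggsCondGauss228
open B2Eq228Conditioning (In Out resIn blkIn gaussProb)

variable {P : HiggsLattice.Params} {N : ℕ} {k : ℕ}
  (C : ChargeData N) (Ω : Finset (HiggsLattice.Site P 0)) (A : HiggsLattice.VecField P 0) {msq a : ℝ}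

/-- **`dμ_{C^{(k)}_Λ(Ω,A)}` IS Mathlib's centred multivariate Gaussian with covariance matrix `A_Λ⁻¹`** (read on `Λ → ℝ`
coordinates through `EuclideanSpace ℝ Λ ≃ (Λ → ℝ)`; p15's `gaussProb_eq_map_multivariateGaussian` at the positive definite
block `A_Λ = (formMat)_Λ`). [cite: Balaban1982Higgs2, (2.28) p.563] -/
theorem condGauss_eq_map_multivariateGaussian (hmsq : 0 < msq) (ha : 0 < a) (hL : 1 < (P.L : ℝ)) (hk : k ≤ P.K)
    (Λ : Finset (HiggsLattice.Site P k)) :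
    condGauss C Ω A msq a k Λ
      = (multivariateGaussian 0 (blkIn (inSet N Λ) (formMat C Ω A msq a k))⁻¹).map
          ⇑(MeasurableEquiv.toLp 2 (In (inSet (P := P) N Λ) → ℝ)).symm := by
  rw [condGauss_eq, B2Eq228Conditioning.gaussProb_eq_map_multivariateGaussian (blkIn_formMat_posDef C Ω A hmsq ha hL hk Λ)]

/-- The same read on `EuclideanSpace ℝ Λ`: the image of `dμ_{C^{(k)}_Λ(Ω,A)}` under `toLp` is `multivariateGaussian 0 A_Λ⁻¹`.
[cite: Balaban1982Higgs2, (2.28) p.563] -/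
theorem map_toLp_condGauss (hmsq : 0 < msq) (ha : 0 < a) (hL : 1 < (P.L : ℝ)) (hk : k ≤ P.K)
    (Λ : Finset (HiggsLattice.Site P k)) :
    (condGauss C Ω A msq a k Λ).map ⇑(MeasurableEquiv.toLp 2 (In (inSet (P := P) N Λ) → ℝ))
      = multivariateGaussian 0 (blkIn (inSet N Λ) (formMat C Ω A msq a k))⁻¹ := by
  set e := MeasurableEquiv.toLp 2 (In (inSet (P := P) N Λ) → ℝ) with he
  rw [condGauss_eq_map_multivariateGaussian C Ω A hmsq ha hL hk Λ, Measure.map_map e.measurable e.symm.measurable,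
    MeasurableEquiv.self_comp_symm, Measure.map_id]

/-- The covariance matrix `A_Λ⁻¹` is positive semidefinite (inverse of a positive definite matrix).
[cite: Balaban1982Higgs2, (2.28) p.563] -/
theorem inv_blkIn_formMat_posSemidef (hmsq : 0 < msq) (ha : 0 < a) (hL : 1 < (P.L : ℝ)) (hk : k ≤ P.K)
    (Λ : Finset (HiggsLattice.Site P k)) : ((blkIn (inSet N Λ) (formMat C Ω A msq a k))⁻¹).PosSemidef :=
  (blkIn_formMat_posDef C Ω A hmsq ha hL hk Λ).inv.posSemidef

/-- **Mean zero**: `∫ φ′(b) dμ_{C^{(k)}_Λ(Ω,A)}(φ′) = 0` for every coordinate `b` of `Λ` (the measure is centred).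
[cite: Balaban1982Higgs2, (2.28) p.563] -/
theorem integral_apply_condGauss (hmsq : 0 < msq) (ha : 0 < a) (hL : 1 < (P.L : ℝ)) (hk : k ≤ P.K)
    (Λ : Finset (HiggsLattice.Site P k)) (b : In (inSet (P := P) N Λ)) :
    ∫ x, x b ∂(condGauss C Ω A msq a k Λ) = 0 := by
  set e := MeasurableEquiv.toLp 2 (In (inSet (P := P) N Λ) → ℝ) with he
  set S := (blkIn (inSet N Λ) (formMat C Ω A msq a k))⁻¹ with hSdef
  have hS : S.PosSemidef := inv_blkIn_formMat_posSemidef C Ω A hmsq ha hL hk Λ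
  have hX : Measurable (fun y : EuclideanSpace ℝ (In (inSet (P := P) N Λ)) => y b) := by fun_prop
  have h1 : ∫ x, x b ∂(condGauss C Ω A msq a k Λ)
      = ∫ y, (fun y : EuclideanSpace ℝ (In (inSet (P := P) N Λ)) => y b) y ∂((condGauss C Ω A msq a k Λ).map ⇑e) := by
    rw [integral_map e.measurable.aemeasurable hX.aestronglyMeasurable]
    rfl
  rw [h1, map_toLp_condGauss C Ω A hmsq ha hL hk Λ, ← hSdef]
  have h2 := (measurePreserving_eval_multivariateGaussian
    (μ := (0 : EuclideanSpace ℝ (In (inSet (P := P) N Λ)))) hS (i := b)).map_eq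
  have h3 : ∫ t, t ∂((multivariateGaussian 0 S).map (fun y : EuclideanSpace ℝ (In (inSet (P := P) N Λ)) => y b))
      = ∫ y, (fun y : EuclideanSpace ℝ (In (inSet (P := P) N Λ)) => y b) y ∂(multivariateGaussian 0 S) :=
    integral_map (φ := fun y : EuclideanSpace ℝ (In (inSet (P := P) N Λ)) => y b) (f := fun t : ℝ => t)
      hX.aemeasurable aestronglyMeasurable_id
  rw [← h3, h2, integral_id_gaussianReal]
  simp

/-- **Covariance `A_Λ⁻¹`**: `cov[φ′(b), φ′(b′); dμ_{C^{(k)}_Λ(Ω,A)}] = (A_Λ⁻¹)_{bb′}` for all coordinates `b, b′` of `Λ`, `A =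
formMat` — II p. 563 *"a probabilistic Gaussian measure with the covariance A_Λ⁻¹"*. PROVED. [cite: Balaban1982Higgs2, (2.28) p.563] -/
theorem covariance_apply_condGauss (hmsq : 0 < msq) (ha : 0 < a) (hL : 1 < (P.L : ℝ)) (hk : k ≤ P.K)
    (Λ : Finset (HiggsLattice.Site P k)) (b b' : In (inSet (P := P) N Λ)) :
    cov[fun x => x b, fun x => x b'; condGauss C Ω A msq a k Λ]
      = ((blkIn (inSet N Λ) (formMat C Ω A msq a k))⁻¹) b b' := by
  set e := MeasurableEquiv.toLp 2 (In (inSet (P := P) N Λ) → ℝ) with he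
  have hS := inv_blkIn_formMat_posSemidef C Ω A hmsq ha hL hk Λ
  have hXa : Measurable (fun y : EuclideanSpace ℝ (In (inSet (P := P) N Λ)) => y b) := by fun_prop
  have hXb : Measurable (fun y : EuclideanSpace ℝ (In (inSet (P := P) N Λ)) => y b') := by fun_prop
  have h := covariance_map (μ := condGauss C Ω A msq a k Λ) hXa.aestronglyMeasurable hXb.aestronglyMeasurable
    e.measurable.aemeasurable
  rw [map_toLp_condGauss C Ω A hmsq ha hL hk Λ, covariance_eval_multivariateGaussian hS] at h
  rw [h]
  rfl

/-- **… and `A_Λ⁻¹` is the block of (2.32)**: `cov[φ′(b), φ′(b′); dμ_{C^{(k)}_Λ(Ω,A)}] = (L^kε)^{−d}·(mat C^{(k)}_Λ(Ω,A))_{bb′}`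
(file 3's `inv_blkIn_formMat`; `mat` = p35's coordinate matrix, so with the weight `(L^kε)^d` of (1.5) this is the
covariance operator `C^{(k)}_Λ(Ω,A)` of `HiggsCondCov232`). PROVED. [cite: Balaban1982Higgs1, (2.32) p.611] -/
theorem covariance_apply_condGauss_eq_condCov232 (hmsq : 0 < msq) (ha : 0 < a) (hL : 1 < (P.L : ℝ)) (hk : k ≤ P.K)
    (Λ : Finset (HiggsLattice.Site P k)) (b b' : In (inSet (P := P) N Λ)) :
    cov[fun x => x b, fun x => x b'; condGauss C Ω A msq a k Λ]
      = (P.mesh k ^ P.d)⁻¹ * mat (condCov232 C Ω A msq a k Λ) b.1 b'.1 := by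
  rw [covariance_apply_condGauss C Ω A hmsq ha hL hk, inv_blkIn_formMat C Ω A hmsq ha hL hk Λ]
  rfl


/-! ## Square integrability and the second moments `∫ φ′(b)φ′(b′) dμ = (A_Λ⁻¹)_{bb′}` -/

/-- The coordinates are square integrable under `dμ_{C^{(k)}_Λ(Ω,A)}` (Gaussian measure; Mathlib's `IsGaussian.memLp_dual`).
[cite: Balaban1982Higgs2, (2.28) p.563] -/
theorem memLp_apply_condGauss (hmsq : 0 < msq) (ha : 0 < a) (hL : 1 < (P.L : ℝ)) (hk : k ≤ P.K)
    (Λ : Finset (HiggsLattice.Site P k)) (b : In (inSet (P := P) N Λ)) :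
    MemLp (fun x : In (inSet (P := P) N Λ) → ℝ => x b) 2 (condGauss C Ω A msq a k Λ) := by
  set e := MeasurableEquiv.toLp 2 (In (inSet (P := P) N Λ) → ℝ) with he
  have hG : MemLp (fun y : EuclideanSpace ℝ (In (inSet (P := P) N Λ)) => y b) 2
      ((condGauss C Ω A msq a k Λ).map ⇑e) := by
    rw [map_toLp_condGauss C Ω A hmsq ha hL hk Λ, ← EuclideanSpace.coe_proj ℝ]
    exact IsGaussian.memLp_dual _ (EuclideanSpace.proj b) 2 (by simp)
  exact hG.comp_of_map e.measurable.aemeasurable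

/-- The coordinates are integrable under `dμ_{C^{(k)}_Λ(Ω,A)}`. [cite: Balaban1982Higgs2, (2.28) p.563] -/
theorem integrable_apply_condGauss (hmsq : 0 < msq) (ha : 0 < a) (hL : 1 < (P.L : ℝ)) (hk : k ≤ P.K)
    (Λ : Finset (HiggsLattice.Site P k)) (b : In (inSet (P := P) N Λ)) :
    Integrable (fun x : In (inSet (P := P) N Λ) → ℝ => x b) (condGauss C Ω A msq a k Λ) := by
  haveI := isProbabilityMeasure_condGauss C Ω A hmsq ha hL hk Λ
  exact (memLp_apply_condGauss C Ω A hmsq ha hL hk Λ b).integrable one_le_two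

/-- Products of two coordinates are integrable under `dμ_{C^{(k)}_Λ(Ω,A)}`. [cite: Balaban1982Higgs2, (2.28) p.563] -/
theorem integrable_mul_apply_condGauss (hmsq : 0 < msq) (ha : 0 < a) (hL : 1 < (P.L : ℝ)) (hk : k ≤ P.K)
    (Λ : Finset (HiggsLattice.Site P k)) (b b' : In (inSet (P := P) N Λ)) :
    Integrable (fun x : In (inSet (P := P) N Λ) → ℝ => x b * x b') (condGauss C Ω A msq a k Λ) :=
  (memLp_apply_condGauss C Ω A hmsq ha hL hk Λ b).integrable_mul (memLp_apply_condGauss C Ω A hmsq ha hL hk Λ b')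

/-- **Second moments `∫ φ′(b) φ′(b′) dμ_{C^{(k)}_Λ(Ω,A)} = (A_Λ⁻¹)_{bb′}`** (centred measure: second moment = covariance).
PROVED. [cite: Balaban1982Higgs2, (2.28) p.563] -/
theorem integral_mul_apply_condGauss (hmsq : 0 < msq) (ha : 0 < a) (hL : 1 < (P.L : ℝ)) (hk : k ≤ P.K)
    (Λ : Finset (HiggsLattice.Site P k)) (b b' : In (inSet (P := P) N Λ)) :
    ∫ x, x b * x b' ∂(condGauss C Ω A msq a k Λ)
      = ((blkIn (inSet N Λ) (formMat C Ω A msq a k))⁻¹) b b' := by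
  haveI := isProbabilityMeasure_condGauss C Ω A hmsq ha hL hk Λ
  have h := covariance_eq_sub (memLp_apply_condGauss C Ω A hmsq ha hL hk Λ b)
    (memLp_apply_condGauss C Ω A hmsq ha hL hk Λ b')
  rw [covariance_apply_condGauss C Ω A hmsq ha hL hk Λ b b'] at h
  have h0 : ∫ x, x b ∂(condGauss C Ω A msq a k Λ) = 0 := integral_apply_condGauss C Ω A hmsq ha hL hk Λ b
  have h0' : ∫ x, x b' ∂(condGauss C Ω A msq a k Λ) = 0 := integral_apply_condGauss C Ω A hmsq ha hL hk Λ b'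
  have h1 : (fun x : In (inSet (P := P) N Λ) → ℝ => x b) * (fun x => x b') = fun x => x b * x b' := rfl
  rw [h1, h0, h0', mul_zero, sub_zero] at h
  exact h.symm

/-- … `= (L^kε)^{−d}·(mat C^{(k)}_Λ(Ω,A))_{bb′}` (file 3's `inv_blkIn_formMat`). PROVED. [cite: Balaban1982Higgs1, (2.32) p.611] -/
theorem integral_mul_apply_condGauss_eq_condCov232 (hmsq : 0 < msq) (ha : 0 < a) (hL : 1 < (P.L : ℝ)) (hk : k ≤ P.K)
    (Λ : Finset (HiggsLattice.Site P k)) (b b' : In (inSet (P := P) N Λ)) :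
    ∫ x, x b * x b' ∂(condGauss C Ω A msq a k Λ)
      = (P.mesh k ^ P.d)⁻¹ * mat (condCov232 C Ω A msq a k Λ) b.1 b'.1 := by
  rw [integral_mul_apply_condGauss C Ω A hmsq ha hL hk, inv_blkIn_formMat C Ω A hmsq ha hL hk Λ]
  rfl

/-! ## Field-level moments for the scalar product (1.5): `∫⟨f,φ′⟩dμ = 0`, `∫⟨f,φ′⟩⟨g,φ′⟩dμ = ⟨f, C^{(k)}_Λ(Ω,A)g⟩` -/

/-- Bilinear form of file 3's `siteInner_condCov232_eq_blkIn`: `⟨f, C^{(k)}_Λ(Ω,A)g⟩_{(1.5)} = (L^kε)^d·(fieldCoord f)↾_Λ ·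
(mat C^{(k)}_Λ)_Λ (fieldCoord g)↾_Λ`. [cite: Balaban1982Higgs1, (2.32) p.611] -/
theorem siteInner_condCov232_eq_blkIn₂ (Λ : Finset (HiggsLattice.Site P k)) (f g : ScalarField P k N) :
    siteInner f (condCov232 C Ω A msq a k Λ g)
      = P.mesh k ^ P.d * (resIn (inSet N Λ) (fieldCoord (E N) (HiggsLattice.Site P k) f)
          ⬝ᵥ (blkIn (inSet N Λ) (mat (condCov232 C Ω A msq a k Λ))
              *ᵥ resIn (inSet N Λ) (fieldCoord (E N) (HiggsLattice.Site P k) g))) := by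
  rw [blkIn_mat_mulVec, fieldOfCrd_resIn, condCov232_cutTo]
  have hsupp : condCov232 C Ω A msq a k Λ g = cutTo Λ (condCov232 C Ω A msq a k Λ g) := by
    funext y
    by_cases hy : y ∈ Λ
    · rw [cutTo_of_mem Λ _ hy]
    · rw [cutTo_of_not_mem Λ _ hy, condCov232_apply_of_not_mem C Ω A msq a k Λ g hy]
  conv_lhs => rw [hsupp, ← fieldOfCrd_resIn]
  rw [siteInner_fieldOfCrd]

/-- **Mean zero, field level**: `∫ ⟨f, φ′⟩ dμ_{C^{(k)}_Λ(Ω,A)}(φ′) = 0` for every field `f` on `T^{(k)}`. PROVED.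
[cite: Balaban1982Higgs2, (2.28) p.563] -/
theorem integral_siteInner_condGauss (hmsq : 0 < msq) (ha : 0 < a) (hL : 1 < (P.L : ℝ)) (hk : k ≤ P.K)
    (Λ : Finset (HiggsLattice.Site P k)) (f : ScalarField P k N) :
    ∫ x, siteInner f (fieldOfCrd Λ x) ∂(condGauss C Ω A msq a k Λ) = 0 := by
  simp_rw [siteInner_fieldOfCrd, dotProduct]
  rw [integral_const_mul, integral_finsetSum _ (fun b _ =>
    (integrable_apply_condGauss C Ω A hmsq ha hL hk Λ b).const_mul _)]
  simp_rw [integral_const_mul, integral_apply_condGauss C Ω A hmsq ha hL hk Λ, mul_zero, Finset.sum_const_zero,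
    mul_zero]

/-- **Second moment, field level — `dμ_{C^{(k)}_Λ(Ω,A)}` has covariance `C^{(k)}_Λ(Ω,A)` for the scalar product (1.5)**:
`∫ ⟨f, φ′⟩⟨g, φ′⟩ dμ_{C^{(k)}_Λ(Ω,A)}(φ′) = ⟨f, C^{(k)}_Λ(Ω,A) g⟩` for all fields `f, g` on `T^{(k)}` (m² > 0, a > 0, L > 1,
k ≤ K; every `A`, `Ω`, `C`, `Λ`). PROVED. [cite: Balaban1982Higgs1, (2.32) p.611] -/
theorem integral_siteInner_mul_siteInner_condGauss (hmsq : 0 < msq) (ha : 0 < a) (hL : 1 < (P.L : ℝ)) (hk : k ≤ P.K)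
    (Λ : Finset (HiggsLattice.Site P k)) (f g : ScalarField P k N) :
    ∫ x, siteInner f (fieldOfCrd Λ x) * siteInner g (fieldOfCrd Λ x) ∂(condGauss C Ω A msq a k Λ)
      = siteInner f (condCov232 C Ω A msq a k Λ g) := by
  set w : ℝ := P.mesh k ^ P.d with hw_def
  set rf := resIn (inSet N Λ) (fieldCoord (E N) (HiggsLattice.Site P k) f) with hrf
  set rg := resIn (inSet N Λ) (fieldCoord (E N) (HiggsLattice.Site P k) g) with hrg
  have hw : w ≠ 0 := (pow_pos (P.mesh_pos k) _).ne'
  have key : ∀ x : In (inSet (P := P) N Λ) → ℝ,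
      siteInner f (fieldOfCrd Λ x) * siteInner g (fieldOfCrd Λ x)
        = w ^ 2 * ∑ b, ∑ b', rf b * rg b' * (x b * x b') := by
    intro x
    rw [siteInner_fieldOfCrd, siteInner_fieldOfCrd, ← hw_def, ← hrf, ← hrg, dotProduct, dotProduct]
    have hprod : (∑ b, rf b * x b) * (∑ b', rg b' * x b') = ∑ b, ∑ b', rf b * rg b' * (x b * x b') := by
      rw [Finset.sum_mul_sum]
      refine Finset.sum_congr rfl fun b _ => Finset.sum_congr rfl fun b' _ => ?_
      ring
    rw [← hprod]
    ring
  simp_rw [key]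
  rw [integral_const_mul, integral_finsetSum _ (fun b _ => integrable_finsetSum _ (fun b' _ =>
    (integrable_mul_apply_condGauss C Ω A hmsq ha hL hk Λ b b').const_mul _))]
  simp_rw [integral_finsetSum _ (fun b' _ => (integrable_mul_apply_condGauss C Ω A hmsq ha hL hk Λ _ b').const_mul _),
    integral_const_mul, integral_mul_apply_condGauss C Ω A hmsq ha hL hk Λ, inv_blkIn_formMat C Ω A hmsq ha hL hk Λ,
    siteInner_condCov232_eq_blkIn₂, ← hw_def, ← hrf, ← hrg, Matrix.smul_apply, smul_eq_mul, dotProduct, Matrix.mulVec,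
    dotProduct, Finset.mul_sum]
  refine Finset.sum_congr rfl fun b _ => Finset.sum_congr rfl fun b' _ => ?_
  field_simp

end Literature.MathematicalPhysics.QuantumFieldTheory.Balaban1983to89.HiggsCondGaussMoments
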